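import Summits.QuantumAdvantage.AdviceFreeQNC0.Transport
import Summits.QuantumAdvantage.AdviceFreeQNC0.SymmetricCount
import Summits.QuantumAdvantage.AdviceFreeQNC0.SymmetricCodewords
import HarnessLib

/-!
# Cell qa-qnc0 (rung F-Q1, density axis): the UNREDUCED transport statement is FALSE at `m = 15` —
# `¬ TransportAll 15 K0sym15` (planner qa-qnc0-p1 ROUND-13 §2.14, Sketch16; ask P21)

Planner qa-qnc0-p1 gen 14 (kit C18/C27 + hand certificate, ROUND-13 §2.14): `TransportAll 15 K0sym15` (unreduced
transport in the window, `Transport.lean`) fails at the shell pattern `K0sym15` (zeros on the shells `4, 5, 10, 11`).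
Kernel form: blocks `B₁ = {0,1}`, `B₂ = {2..6}`, `S₂ = {7..14}` (`S₁ = B₁ ∪ B₂`), block weights `(a, b, c)`;
`E := A ∪ J`, `A = {a+b even, c even, |u| ∈ {2,8,14}}` (`|A| = 3291`), `J` = five block-weight cells inside
`Q ∩ O₀` (`|J| = 1068`; `|E| = 4359`, `2|E| ≤ |Z| = 8736`); codewords `W0 = (∅; even; even)`,
`W1 = ({χ_{S₁}=1}; ∅; {χ_{S₁}=1})`, `W2 = ({χ_{S₂}=1}; ∅; {χ_{S₂}=1})` demand
`2n(Z∩W0) ≥ 2·3291 − (6555 − 4368) = 4395`, `2n(Z∩W1) ≥ 2·4359 − (8752 − 2184) = 2150`,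
`2n(Z∩W2) ≥ 2·4359 − (8725 − 2184) = 2177` on three DISJOINT parts of `Z`: total `8722 > 8718 = 2|E| ≥ 2n(Z)`.
All counts are binomial box sums over the block weights (qn-lit g12's `SymCount` engine), by `decide`; every
counting statement goes through the generic `pwt` / `failCount` / `inCount` / `outCount` / `triCount` so that no
instance is synthesised at the literal `Fin 15` (which would not match `Transport.lean`'s).
Consequences (planner): `starOfTransport` consumes the REDUCED `TransportCert`, so nothing else breaks; the conjecture
of record becomes `TransportFifteenR` (Sketch16 verbatim, with `oneWordMI_fifteen_of_transportR`);
`not_transportFifteen_of_isOpt1 : IsOpt1 15 K0sym15 → IsSymPat K0sym15 → ¬ TransportFifteen`.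
WHAT THIS IS NOT: nothing on the reduced transport / `CertFifteen` / `MassIneqAll` (OPEN); `IsOpt1 15 K0sym15` is
qn-lit's `w(15,1) = 8736` theorem, not re-proved here; nothing on α; separation NOT moved.
-/

namespace Summit.QuantumAdvantage.AdviceFreeQNC0

open Finset
open Literature.Computability.MetaComplexity Literature.Computability.MetaComplexity.Smolensky
open MassInequality SymCount

/-! ### Sketch16 statements (qn-p1 g14), verbatim -/

/-- The symmetric optimum pattern at `m = 15`: `K0 u = false` iff `wt u ∈ {4, 5, 10, 11}` (so `Z(K0)` = shells
4, 5, 10, 11, `|Z| = 8736`).  (Sketch16, verbatim.) -/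
def K0sym15 (u : Fin 15 → Bool) : Bool :=
  !(wt u == 4 || wt u == 5 || wt u == 10 || wt u == 11)

/-- **NEGATIVE ITEM (M, finite).**  Unreduced transport in the window FAILS at the symmetric optimum of `C_15`.
(Sketch16, verbatim; proved below as `notTransportAllSym15`.) -/
def NotTransportAllSym15 : Prop := ¬ TransportAll 15 K0sym15

/-- **CONJECTURE OF RECORD (rank-1 slice at m = 15), REDUCED form** — replaces `TransportFifteen` (false as typed):
every REDUCED outside set at a symmetric optimum admits a transport.  OPEN.  (Sketch16, verbatim.) -/
def TransportFifteenR : Prop :=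
  ∀ K0 : (Fin 15 → Bool) → Bool, IsOpt1 15 K0 → IsSymPat K0 → TransportCert 15 K0

/-- support (S): the one-word MI(15) chain from the REDUCED transport.  (Sketch16, verbatim; proved below.) -/
def OneWordMIFifteenOfR : Prop :=
  TransportFifteenR → ∀ K0 : (Fin 15 → Bool) → Bool, IsOpt1 15 K0 → IsSymPat K0 → OneWordMIAt 15 K0

/-- `TransportFifteen` is false once the shell pattern is known to be 1-optimal.  (Sketch16, verbatim up to the
symmetry conjunct that `TransportFifteen` also asks for; proved below as `not_transportFifteen_of_isOpt1`.) -/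
def NotTransportFifteen : Prop := IsOpt1 15 K0sym15 → ¬ TransportFifteen

/-! ### The reduced chain (S) -/

/-- **ONE-WORD MI(15) from the REDUCED transport** (`oneWordMI_fifteen_of_transport` without its first link). -/
theorem oneWordMI_fifteen_of_transportR : OneWordMIFifteenOfR := by
  intro hT K0 ho hs
  exact oneWordOfRelMI 15 K0 (oneWordDecode 15) (relMIOfStar 15 K0 (starOfTransport 15 K0 (hT K0 ho hs)))

/-! ### The block structure and the counting engine at `m = 15` -/

/-! ### Generic bookkeeping (stated at a general `m`, so that instances match `Transport.lean`'s) -/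

section Generic

variable {m : ℕ}

/-- `#{E ∧ Y ∧ K0}` as a function (the count in `IsReduced` / `TransportFor`). -/
def triCount (E Y K0 : (Fin m → Bool) → Bool) : ℕ :=
  (univ.filter fun u : Fin m → Bool => E u = true ∧ Y u = true ∧ K0 u = true).card

/-- `triCount` as a `pwt`. -/
theorem triCount_eq_pwt (E Y K0 : (Fin m → Bool) → Bool) :
    triCount E Y K0 = pwt (fun u => E u && Y u && K0 u) := by
  unfold triCount pwt
  congr 1
  exact Finset.filter_congr fun u _ => by simp only [Bool.and_eq_true]; tauto

/-- `outCount` as a `pwt`. -/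
theorem outCount_eq_pwt (K0 A : (Fin m → Bool) → Bool) :
    MassInequality.outCount K0 A = pwt (fun u => A u && K0 u) := by
  unfold MassInequality.outCount pwt
  congr 1
  exact Finset.filter_congr fun u _ => by simp only [Bool.and_eq_true]

/-- `inCount` as a `pwt`. -/
theorem inCount_eq_pwt (K0 A : (Fin m → Bool) → Bool) :
    MassInequality.inCount K0 A = pwt (fun u => A u && !K0 u) := by
  unfold MassInequality.inCount pwt
  congr 1
  exact Finset.filter_congr fun u _ => by simp only [Bool.and_eq_true, Bool.not_eq_true']

/-- `failCount` as a `pwt`. -/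
theorem failCount_eq_pwt_not (K0 : (Fin m → Bool) → Bool) : failCount K0 = pwt (fun u => !K0 u) := by
  unfold failCount pwt
  congr 1
  exact Finset.filter_congr fun u _ => by simp only [Bool.not_eq_true']

/-- Instantiating `TransportAll` with the window condition in `pwt`/`failCount` form. -/
theorem transportAll_apply {K0 : (Fin m → Bool) → Bool} (h : TransportAll m K0) (E : (Fin m → Bool) → Bool)
    (hE : ∀ u, E u = true → K0 u = true) (hw : 2 * pwt E ≤ failCount K0) : ∃ n, TransportFor m K0 E n :=
  h E hE hw

/-- Unpacking `TransportFor` with the counts named and the restricted sums written over `Z` with indicators. -/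
theorem transportFor_data {K0 E : (Fin m → Bool) → Bool} {n : (Fin m → Bool) → ℚ} (h : TransportFor m K0 E n) :
    (∀ z, K0 z = false → 0 ≤ n z ∧ n z ≤ 1) ∧
      (∑ z ∈ univ.filter (fun z : Fin m → Bool => K0 z = false), n z) ≤ (pwt E : ℚ) ∧
      ∀ Y, IsElim1 m Y →
        2 * (triCount E Y K0 : ℚ) - ((MassInequality.outCount K0 Y : ℚ) - (MassInequality.inCount K0 Y : ℚ)) ≤
          2 * ∑ z ∈ univ.filter (fun z : Fin m → Bool => K0 z = false), (if Y z = true then n z else 0) := by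
  obtain ⟨h1, h2, h3⟩ := h
  refine ⟨h1, h2, fun Y hY => ?_⟩
  have h4 := h3 Y hY
  have hs : (∑ z ∈ univ.filter (fun z : Fin m → Bool => K0 z = false ∧ Y z = true), n z) =
      ∑ z ∈ univ.filter (fun z : Fin m → Bool => K0 z = false), (if Y z = true then n z else 0) := by
    rw [Finset.sum_filter, Finset.sum_filter]
    exact Finset.sum_congr rfl fun z _ => by
      by_cases h1 : K0 z = false <;> by_cases h2 : Y z = true <;> simp [h1, h2]
  rw [hs] at h4
  exact h4

/-- Three indicator-restricted sums with pointwise disjoint supports on `Z` fit inside the total. -/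
theorem three_le_total (K0 Y0 Y1 Y2 : (Fin m → Bool) → Bool) (n : (Fin m → Bool) → ℚ)
    (hdisj : ∀ z, K0 z = false → ∀ x : ℚ, 0 ≤ x →
      (if Y0 z = true then x else 0) + (if Y1 z = true then x else 0) + (if Y2 z = true then x else 0) ≤ x)
    (hn : ∀ z, K0 z = false → 0 ≤ n z) :
    (∑ z ∈ univ.filter (fun z : Fin m → Bool => K0 z = false), (if Y0 z = true then n z else 0)) +
      (∑ z ∈ univ.filter (fun z : Fin m → Bool => K0 z = false), (if Y1 z = true then n z else 0)) +
      (∑ z ∈ univ.filter (fun z : Fin m → Bool => K0 z = false), (if Y2 z = true then n z else 0)) ≤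
      ∑ z ∈ univ.filter (fun z : Fin m → Bool => K0 z = false), n z := by
  rw [← Finset.sum_add_distrib, ← Finset.sum_add_distrib]
  refine Finset.sum_le_sum fun z hz => ?_
  have hz' : K0 z = false := (Finset.mem_filter.1 hz).2
  exact hdisj z hz' (n z) (hn z hz')

end Generic

namespace Refute15

/-- `S₁ = {0,…,6}`. -/
def S0 : Finset (Fin 15) := univ.filter fun i => i.val < 7
/-- `B₁ = {0, 1}` (so the blocks of `(S0, S1)` are `{0,1}`, `{2,…,6}`, `∅`, `{7,…,14}`). -/
def S1 : Finset (Fin 15) := univ.filter fun i => i.val < 2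
/-- `S₂ = {7,…,14}`, the last block. -/
def S2 : Finset (Fin 15) := block S0 S1 (false, false)

/-- Block sizes `(2, 5, 0, 8)`. -/
theorem bs_vals : bs S0 S1 (true, true) = 2 ∧ bs S0 S1 (true, false) = 5 ∧ bs S0 S1 (false, true) = 0 ∧
    bs S0 S1 (false, false) = 8 := by
  unfold bs block lab S0 S1
  decide

/-- **Counting by block weights** at this block structure: a `G4q 2 5 0 8` box sum.  (All counting
statements go through the generic `pwt`, so that no `Fintype` instance is synthesised at the literal `Fin 15`.) -/
theorem count (ψ : ℕ × ℕ × ℕ × ℕ → Bool) :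
    pwt (fun u : Fin 15 → Bool => ψ (bw4 S0 S1 u)) = G4q 2 5 0 8 ψ := by
  obtain ⟨h1, h2, h3, h4⟩ := bs_vals
  unfold pwt
  beta_reduce
  rw [card_filter_eq_sum_box4, sum_box4_eq_G4, h1, h2, h3, h4, G4q_eq]

/-- The total weight of a block-weight tuple. -/
def wsum (k : ℕ × ℕ × ℕ × ℕ) : ℕ := k.1 + k.2.1 + k.2.2.1 + k.2.2.2

/-- `K0sym15` through block weights. -/
def φK (k : ℕ × ℕ × ℕ × ℕ) : Bool := !(wsum k == 4 || wsum k == 5 || wsum k == 10 || wsum k == 11)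
/-- `A = Q ∩ O₂`: `a + b` even, `c` even, weight `2, 8, 14`. -/
def φA (k : ℕ × ℕ × ℕ × ℕ) : Bool :=
  ((k.1 + k.2.1) % 2 == 0) && (k.2.2.2 % 2 == 0) && (wsum k == 2 || wsum k == 8 || wsum k == 14)

/-- `J ⊆ Q ∩ O₀`: five explicit block-weight cells, `980 + 70 + 1 + 7 + 10 = 1068` points. -/
def φJ (k : ℕ × ℕ × ℕ × ℕ) : Bool :=
  (k.2.2.1 == 0) && ((k.1 + k.2.1 == 4 && k.2.2.2 == 2) || (k.1 == 2 && k.2.1 == 0 && k.2.2.2 == 4) ||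
    (k.1 == 0 && k.2.1 == 0 && k.2.2.2 == 0) || (k.1 + k.2.1 == 6 && k.2.2.2 == 0) ||
    (k.1 == 2 && k.2.1 == 2 && k.2.2.2 == 8))

/-- `E = A ∪ J`. -/
def φE (k : ℕ × ℕ × ℕ × ℕ) : Bool := φA k || φJ k
/-- `W0 = (∅; even; even)` through block weights. -/
def φW0 (k : ℕ × ℕ × ℕ × ℕ) : Bool := sel (wsum k % 3) false (xor true (par (wsum k)))
/-- `W1 = ({χ_{S₁}=1}; ∅; {χ_{S₁}=1})` through block weights. -/
def φW1 (k : ℕ × ℕ × ℕ × ℕ) : Bool := sel (wsum k % 3) (xor true (par (k.1 + k.2.1))) false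
/-- `W2 = ({χ_{S₂}=1}; ∅; {χ_{S₂}=1})` through block weights. -/
def φW2 (k : ℕ × ℕ × ℕ × ℕ) : Bool := sel (wsum k % 3) (xor true (par k.2.2.2)) false

/-- The error set `E`. -/
def Eset (u : Fin 15 → Bool) : Bool := φE (bw4 S0 S1 u)

/-- The codeword `W0 = (∅; even; even)`. -/
def W0 : (Fin 15 → Bool) → Bool := cwOf ((∅ : Finset (Fin 15)), false) (S0 ∪ S2, true)
/-- The codeword `W1 = ({χ_{S₁}=1}; ∅; {χ_{S₁}=1})`. -/
def W1 : (Fin 15 → Bool) → Bool := cwOf (S0, true) ((∅ : Finset (Fin 15)), false)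
/-- The codeword `W2 = ({χ_{S₂}=1}; ∅; {χ_{S₂}=1})`. -/
def W2 : (Fin 15 → Bool) → Bool := cwOf (S2, true) ((∅ : Finset (Fin 15)), false)

/-- `wt u` is the total block weight. -/
theorem wt_eq (u : Fin 15 → Bool) : wt u = wsum (bw4 S0 S1 u) := by
  rw [wt_eq_bw_sum S0 S1 u]; rfl

/-- `K0sym15` depends on block weights only. -/
theorem K0_eq (u : Fin 15 → Bool) : K0sym15 u = φK (bw4 S0 S1 u) := by
  unfold K0sym15 φK; rw [wt_eq]

/-- `|u ∩ (S₁ ∪ S₂)| = a + b + c` (the block `(false, true)` is empty, `S₂` is the block `(false, false)`). -/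
theorem card_filter_S0_union_S2 (u : Fin 15 → Bool) :
    ((S0 ∪ S2).filter fun i => u i = true).card = wsum (bw4 S0 S1 u) := by
  have hdisj : Disjoint (S0.filter fun i => u i = true) (S2.filter fun i => u i = true) := by
    rw [Finset.disjoint_left]
    intro i hi hi2
    rw [Finset.mem_filter] at hi hi2
    have h2 := hi2.1
    unfold S2 block lab at h2
    rw [Finset.mem_filter] at h2
    have := h2.2
    simp only [Prod.mk.injEq, decide_eq_false_iff_not] at this
    exact this.1 hi.1
  rw [Finset.filter_union, Finset.card_union_of_disjoint hdisj, card_filter_S0 S0 S1 u]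
  have hft : bw S0 S1 u (false, true) = 0 := by
    have h := bw_le S0 S1 u (false, true)
    have h3 := bs_vals.2.2.1
    unfold bs at h3
    omega
  unfold wsum bw4
  simp only
  rw [hft]
  rfl

/-- `W0` depends on block weights only. -/
theorem W0_eq (u : Fin 15 → Bool) : W0 u = φW0 (bw4 S0 S1 u) := by
  unfold W0 cwOf tripleOf φW0
  rw [affEval_eq_par, affEval_eq_par, card_filter_S0_union_S2 u, wt_eq u]
  simp only [Finset.filter_empty, Finset.card_empty, show par 0 = false from rfl, Bool.xor_false]

/-- `W1` depends on block weights only. -/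
theorem W1_eq (u : Fin 15 → Bool) : W1 u = φW1 (bw4 S0 S1 u) := by
  unfold W1 cwOf tripleOf φW1
  rw [affEval_eq_par, affEval_eq_par, card_filter_S0 S0 S1 u, wt_eq u]
  simp only [Finset.filter_empty, Finset.card_empty, show par 0 = false from rfl, Bool.xor_false]
  rfl

/-- `W2` depends on block weights only. -/
theorem W2_eq (u : Fin 15 → Bool) : W2 u = φW2 (bw4 S0 S1 u) := by
  unfold W2 cwOf tripleOf φW2 S2
  rw [affEval_eq_par, affEval_eq_par, wt_eq u]
  simp only [Finset.filter_empty, Finset.card_empty, show par 0 = false from rfl, Bool.xor_false]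
  rfl

/-- The codewords are codewords. -/
theorem isElim1_W : IsElim1 15 W0 ∧ IsElim1 15 W1 ∧ IsElim1 15 W2 :=
  ⟨isElim1_cwOf _ _, isElim1_cwOf _ _, isElim1_cwOf _ _⟩

/-! ### The finite facts (box sums and box checks, `decide`) -/

/-- `|E| = 4359`. -/
theorem card_E : pwt Eset = 4359 := by
  rw [show Eset = fun u => φE (bw4 S0 S1 u) from rfl, count]
  decide

/-- `|Z| = 8736`. -/
theorem card_Z : failCount K0sym15 = 8736 := by
  rw [failCount_eq_pwt_not, show (fun u => !K0sym15 u) = fun u => (fun k => !φK k) (bw4 S0 S1 u) from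
    funext fun u => by rw [K0_eq], count (fun k => !φK k)]
  decide

/-- The transport data of `W0`: `|E ∩ W0 ∩ Out| = 3291`, `b = 6555`, `a = 4368`. -/
theorem data_W0 : triCount Eset W0 K0sym15 = 3291 ∧
    MassInequality.outCount K0sym15 W0 = 6555 ∧ MassInequality.inCount K0sym15 W0 = 4368 := by
  refine ⟨?_, ?_, ?_⟩
  · rw [triCount_eq_pwt, show (fun u => Eset u && W0 u && K0sym15 u) =
      fun u => (fun k => φE k && φW0 k && φK k) (bw4 S0 S1 u) from funext fun u => by rw [W0_eq, K0_eq]; rfl,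
      count (fun k => φE k && φW0 k && φK k)]
    decide
  · rw [outCount_eq_pwt, show (fun u => W0 u && K0sym15 u) =
      fun u => (fun k => φW0 k && φK k) (bw4 S0 S1 u) from funext fun u => by rw [W0_eq, K0_eq],
      count (fun k => φW0 k && φK k)]
    decide
  · rw [inCount_eq_pwt, show (fun u => W0 u && !K0sym15 u) =
      fun u => (fun k => φW0 k && !φK k) (bw4 S0 S1 u) from funext fun u => by rw [W0_eq, K0_eq],
      count (fun k => φW0 k && !φK k)]
    decide

/-- The transport data of `W1`: `|E ∩ W1 ∩ Out| = 4359`, `b = 8752`, `a = 2184`. -/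
theorem data_W1 : triCount Eset W1 K0sym15 = 4359 ∧
    MassInequality.outCount K0sym15 W1 = 8752 ∧ MassInequality.inCount K0sym15 W1 = 2184 := by
  refine ⟨?_, ?_, ?_⟩
  · rw [triCount_eq_pwt, show (fun u => Eset u && W1 u && K0sym15 u) =
      fun u => (fun k => φE k && φW1 k && φK k) (bw4 S0 S1 u) from funext fun u => by rw [W1_eq, K0_eq]; rfl,
      count (fun k => φE k && φW1 k && φK k)]
    decide
  · rw [outCount_eq_pwt, show (fun u => W1 u && K0sym15 u) =
      fun u => (fun k => φW1 k && φK k) (bw4 S0 S1 u) from funext fun u => by rw [W1_eq, K0_eq],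
      count (fun k => φW1 k && φK k)]
    decide
  · rw [inCount_eq_pwt, show (fun u => W1 u && !K0sym15 u) =
      fun u => (fun k => φW1 k && !φK k) (bw4 S0 S1 u) from funext fun u => by rw [W1_eq, K0_eq],
      count (fun k => φW1 k && !φK k)]
    decide

/-- The transport data of `W2`: `|E ∩ W2 ∩ Out| = 4359`, `b = 8725`, `a = 2184`. -/
theorem data_W2 : triCount Eset W2 K0sym15 = 4359 ∧
    MassInequality.outCount K0sym15 W2 = 8725 ∧ MassInequality.inCount K0sym15 W2 = 2184 := by
  refine ⟨?_, ?_, ?_⟩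
  · rw [triCount_eq_pwt, show (fun u => Eset u && W2 u && K0sym15 u) =
      fun u => (fun k => φE k && φW2 k && φK k) (bw4 S0 S1 u) from funext fun u => by rw [W2_eq, K0_eq]; rfl,
      count (fun k => φE k && φW2 k && φK k)]
    decide
  · rw [outCount_eq_pwt, show (fun u => W2 u && K0sym15 u) =
      fun u => (fun k => φW2 k && φK k) (bw4 S0 S1 u) from funext fun u => by rw [W2_eq, K0_eq],
      count (fun k => φW2 k && φK k)]
    decide
  · rw [inCount_eq_pwt, show (fun u => W2 u && !K0sym15 u) =
      fun u => (fun k => φW2 k && !φK k) (bw4 S0 S1 u) from funext fun u => by rw [W2_eq, K0_eq],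
      count (fun k => φW2 k && !φK k)]
    decide

/-- Box checks: `E ⊆ Out`, and on `Z` at most one of `W0, W1, W2` holds. -/
theorem box_checks : ∀ k ∈ box4 S0 S1,
    (φE k = true → φK k = true) ∧
      (φK k = false → (φW0 k = true → φW1 k = false ∧ φW2 k = false) ∧ (φW1 k = true → φW2 k = false)) := by
  obtain ⟨h1, h2, h3, h4⟩ := bs_vals
  unfold box4
  rw [h1, h2, h3, h4]
  decide +kernel

/-- `E ⊆ Out`. -/
theorem E_out (u : Fin 15 → Bool) (hu : Eset u = true) : K0sym15 u = true := by
  rw [K0_eq]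
  exact (box_checks _ (bw4_mem_box4 S0 S1 u)).1 hu

/-- On `Z`, the three words have disjoint supports (pointwise budget form). -/
theorem disjoint_on_Z (u : Fin 15 → Bool) (hz : K0sym15 u = false) (x : ℚ) (hx : 0 ≤ x) :
    (if W0 u = true then x else 0) + (if W1 u = true then x else 0) + (if W2 u = true then x else 0) ≤ x := by
  rw [K0_eq] at hz
  rw [W0_eq, W1_eq, W2_eq]
  have h := (box_checks _ (bw4_mem_box4 S0 S1 u)).2 hz
  by_cases h0 : φW0 (bw4 S0 S1 u) = true
  · obtain ⟨h1, h2⟩ := h.1 h0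
    rw [if_pos h0, if_neg (by rw [h1]; exact Bool.false_ne_true), if_neg (by rw [h2]; exact Bool.false_ne_true)]
    linarith
  · rw [if_neg h0]
    by_cases h1 : φW1 (bw4 S0 S1 u) = true
    · rw [if_pos h1, if_neg (by rw [h.2 h1]; exact Bool.false_ne_true)]; linarith
    · rw [if_neg h1]; split_ifs <;> linarith

/-- The window condition `2|E| ≤ |Z|`. -/
theorem window_E : 2 * pwt Eset ≤ failCount K0sym15 := by
  rw [card_E, card_Z]; norm_num

/-- **No transport exists for the error set `E`.** -/
theorem no_transport_E (n : (Fin 15 → Bool) → ℚ) (hn : TransportFor 15 K0sym15 Eset n) : False := by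
  obtain ⟨hn01, hmass, htr⟩ := transportFor_data hn
  rw [card_E] at hmass
  obtain ⟨hW0, hW1, hW2⟩ := isElim1_W
  have h0 := htr W0 hW0
  have h1 := htr W1 hW1
  have h2 := htr W2 hW2
  obtain ⟨e0, b0, a0⟩ := data_W0
  obtain ⟨e1, b1, a1⟩ := data_W1
  obtain ⟨e2, b2, a2⟩ := data_W2
  rw [e0, b0, a0] at h0
  rw [e1, b1, a1] at h1
  rw [e2, b2, a2] at h2
  push_cast at h0 h1 h2 hmass
  have hle := three_le_total K0sym15 W0 W1 W2 n (fun z hz x hx => disjoint_on_Z z hz x hx)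
    (fun z hz => (hn01 z hz).1)
  linarith

end Refute15

open Refute15

/-! ### The refutation -/

/-- **`¬ TransportAll 15 K0sym15`** — the unreduced transport statement FAILS at the shell pattern of `C_15`
(ROUND-13 §2.14: the explicit non-reduced error set `E`, `|E| = 4359`, and the three codewords `W0, W1, W2`). -/
theorem notTransportAllSym15 : NotTransportAllSym15 := by
  intro hT
  obtain ⟨n, hn⟩ := transportAll_apply hT Eset E_out window_E
  exact no_transport_E n hn

/-- **`TransportFifteen` is false** (as typed in `Transport.lean`: UNREDUCED transport at every symmetric optimum),
given that the shell pattern `K0sym15` is an optimum of `C_15` (qn-lit's `w(15,1) = 8736`) and symmetric. -/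
theorem not_transportFifteen_of_isOpt1 (hopt : IsOpt1 15 K0sym15) (hsym : IsSymPat K0sym15) :
    ¬ TransportFifteen :=
  fun h => notTransportAllSym15 (h K0sym15 hopt hsym)

/-- `K0sym15` is symmetric (its value depends on `wt` only). -/
theorem isSymPat_K0sym15 : IsSymPat K0sym15 := fun u v h => by unfold K0sym15; rw [h]

/-- Hence `NotTransportFifteen` (Sketch16): optimality of the shell pattern alone refutes `TransportFifteen`. -/
theorem notTransportFifteen : NotTransportFifteen :=
  fun hopt => not_transportFifteen_of_isOpt1 hopt isSymPat_K0sym15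

end Summit.QuantumAdvantage.AdviceFreeQNC0
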